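import Summits.QuantumFields.YangMills.Theses.SqueezedSkewness
import Summits.QuantumFields.YangMills.Theorems.SqueezedSkewnessChordEscalator
import Summits.QuantumFields.YangMills.Theorems.SqueezedSkewnessFemtoCeiling
import HarnessLib

/-!
# Route `SqueezedSkewness`, node `PointlikeHypercubeFloors` (stmt-QuantumFields-23205), skeleton
# `Cruxes/NT/Lines/pointlike_node_birth.lean` (planner ym-idea-6 g12): the two S PORTS `stub_chordEscalator`, `stub_femtoCeiling` BY NAME

Registry bookkeeping asked for by the planner (ym-idea-6 g12, 22:35Z «FREE S PORTS for idle hands»): the skeleton's stubs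
`stub_chordEscalator` (= `SqueezedSkewness.ChordEscalator`, item 23546) and `stub_femtoCeiling` (= `SqueezedSkewness.FemtoCeiling`) are the
LANDED theorems `ChordEscalatorProof.chordEscalator_proof` and `FemtoCeilingProof.femtoCeiling_proof`; the name-keyed statements are copied
verbatim into this file's own namespace (pattern of `SqueezedSkewnessAntipodalMarkovGlueNarrow`) and discharged by name, so that the node's
registry shows only its genuinely open stubs (`stub_femtoFloorUnit`, `stub_torusKL`, `stub_lowPassFloorH`, `stub_antipodalMirrorCeiling`).
Cell `ym-idea-1`, width seat `ym-line-sfw-p2-w5` g12 (free hands), `--supports stmt-QuantumFields-23205`.  HONEST FRAMING: zero new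
mathematics; the node, the route's NT statement and R2a (a RECORD rung) are NOT proved; the Yang–Mills mass gap is NOT proved. [folklore]
-/

set_option autoImplicit false

namespace Summit.QuantumFields.YangMills.Theorems.SqueezedSkewnessPointlikeNodePorts

/-! ### Name-keyed statements (verbatim from `Cruxes/NT/Lines/pointlike_node_birth.lean` @0e9f3393) -/
namespace __Registered

/-- = `SqueezedSkewness.ChordEscalator` (support, item 23546) BY NAME. -/
abbrev stub_chordEscalator : Prop :=
  Summit.QuantumFields.YangMills.Theses.SqueezedSkewness.ChordEscalator

/-- = `SqueezedSkewness.FemtoCeiling` (support) BY NAME. -/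
abbrev stub_femtoCeiling : Prop :=
  Summit.QuantumFields.YangMills.Theses.SqueezedSkewness.FemtoCeiling

end __Registered

/-- **Registered stub `stub_chordEscalator` of node 23205, BY NAME**: the landed `ChordEscalatorProof.chordEscalator_proof`. [folklore] -/
theorem stub_chordEscalator : __Registered.stub_chordEscalator :=
  Summit.QuantumFields.YangMills.Theorems.ChordEscalatorProof.chordEscalator_proof

/-- **Registered stub `stub_femtoCeiling` of node 23205, BY NAME**: the landed `FemtoCeilingProof.femtoCeiling_proof`. [folklore] -/
theorem stub_femtoCeiling : __Registered.stub_femtoCeiling :=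
  Summit.QuantumFields.YangMills.Theorems.FemtoCeilingProof.femtoCeiling_proof

end Summit.QuantumFields.YangMills.Theorems.SqueezedSkewnessPointlikeNodePorts
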